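import Summits.Ventures.DiscreteObjects.Hadamard.ConferenceGraph333FixedSubgraph
import Summits.Ventures.DiscreteObjects.Hadamard.ConferenceThreeAdicObstruction
import Summits.Ventures.DiscreteObjects.Hadamard.ConferenceGraph333GroupCensus

/-!
# ORDER 13 EXCLUDED for automorphisms of srg(333,166,82,83); prime-order spectrum ⊆ {2,3,5,7,11,37,41,83};
# 11², 13, 23 ∤ |Aut| (kernel)

Framing: lottery ticket; floor = certified bounds/negative ranges.  Cell pub-namedobj (venture DiscreteObjects),
target (H) = `H(668)`, hadamard gen 30.  Assembly of gen 30's two tools: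
`ConferenceGraph333FixedSubgraph.aut_order13_fixed_srg` (an automorphism of order `13` of an `srg(333,166,82,83)` has
`21` fixed points inducing an `srg(21,10,4,5)`) and `ConferenceThreeAdicObstruction.no_conferenceGraph_21` (no
`srg(21,10,4,5)` exists — 3-adic obstruction, `21 = 3·7`).
* **`no_aut_order_13`**, `no_aut_pow_eq_one_13` — NO AUTOMORPHISM OF ORDER 13 (restriction of `A` to the `21` fixed
  points, as a matrix on the subtype).
* **`aut_prime_spectrum_g30`** — a non-identity automorphism of prime order `p` has **`p ∈ {2,3,5,7,11,37,41,83}`**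
  (gen 28: `11` primes incl. `17`; gen 29: `17` excluded; gen 30: `13` and `23` excluded); `aut_prime_windows_g30`:
  `3: f ≡ 3 (6), 9 ≤ f ≤ 81 · 5: f ≡ 3 (10), 13 ≤ f ≤ 53 · 7: {25,39} · 11: {25} · 37: {0} · 41: {5} · 83: {1}`.
* Group level, for any group `G` of automorphisms: **`autGroup_prime_dvd_card_g30`** (`p ∣ |G| ⇒ p` in that list),
  **`autGroup_card_not_dvd_11_sq`** (`11² ∤ |G|`: a subgroup of order `121` is not cyclic (gen 29), so its `120`
  non-identity elements have order `11` and `25` fixed points each; Burnside `121 · #orbits = 333 + 120·25 = 3333`,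
  not a multiple of `121`), **`autGroup_order_shape_g30`**: `|G|` divides `2^a · 3^b · 5^c · 7^d · 11 · 37 · 41 · 83`.
WORDS: structure of a HYPOTHETICAL object (no srg(333,166,82,83) / C(334) / H(668) is constructed or excluded);
method in print: orbit matrices / fixed subgraphs of srg automorphisms (Behbahani–Lam 2011); instance and kernel proofs
ours (PROVISIONAL).  No `sorry`, no new definitions.
-/

namespace Summit.Ventures.DiscreteObjects.Hadamard

open Finset MulAction

section order13
variable {V : Type*} [Fintype V] [DecidableEq V]

/-- **NO AUTOMORPHISM OF ORDER 13** of an `srg(333,166,82,83)`: its `21` fixed points would induce an `srg(21,10,4,5)`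
(`aut_order13_fixed_srg`), and no conference graph on `21` vertices exists (`no_conferenceGraph_21`). -/
theorem no_aut_order_13 (hV : Fintype.card V = 333) (A : Matrix V V ℤ)
    (h01 : ∀ x y, A x y = 0 ∨ A x y = 1) (hsymm : ∀ x y, A y x = A x y) (hdiag : ∀ x, A x x = 0)
    (hk : ∀ x, ∑ y, A x y = 166) (hsrg : ∀ x y, ∑ z, A x z * A z y = 83 * (1 + (if x = y then 1 else 0)) - A x y)
    (σ : Equiv.Perm V) (hσ : σ ^ 13 = 1) (hσ1 : σ ≠ 1) (hA : ∀ x y, A (σ x) (σ y) = A x y) : False := by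
  classical
  obtain ⟨hf, hS, hT⟩ := aut_order13_fixed_srg hV A h01 hsymm hdiag hk hsrg σ hσ hσ1 hA
  set F := univ.filter fun x => σ x = x with hF
  let B : Matrix F F ℤ := fun a b => A a.1 b.1
  have hcard : Fintype.card F = 21 := by rw [Fintype.card_coe, hf]
  refine no_conferenceGraph_21 hcard B (fun a b => h01 a.1 b.1) (fun a b => hsymm a.1 b.1) (fun a => hdiag a.1)
    (fun a => ?_) (fun a b => ?_)
  · show ∑ b : F, A a.1 b.1 = 10
    rw [Finset.sum_coe_sort F (fun y => A a.1 y)]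
    exact hS a.1 a.2
  · show ∑ c : F, A a.1 c.1 * A c.1 b.1 = 5 * (1 + (if a = b then 1 else 0)) - A a.1 b.1
    rw [Finset.sum_coe_sort F (fun z => A a.1 z * A z b.1), hT a.1 a.2 b.1 b.2]
    by_cases hab : a = b
    · rw [if_pos hab, if_pos (congrArg Subtype.val hab)]
    · rw [if_neg hab, if_neg (fun h => hab (Subtype.ext h))]

/-- `σ^(13k) = 1 ⇒ σ^k = 1` (no element of order divisible by `13`). -/
theorem no_aut_pow_eq_one_13 (hV : Fintype.card V = 333) (A : Matrix V V ℤ)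
    (h01 : ∀ x y, A x y = 0 ∨ A x y = 1) (hsymm : ∀ x y, A y x = A x y) (hdiag : ∀ x, A x x = 0)
    (hk : ∀ x, ∑ y, A x y = 166) (hsrg : ∀ x y, ∑ z, A x z * A z y = 83 * (1 + (if x = y then 1 else 0)) - A x y)
    (σ : Equiv.Perm V) {k : ℕ} (hσ : σ ^ (13 * k) = 1) (hA : ∀ x y, A (σ x) (σ y) = A x y) : σ ^ k = 1 := by
  by_contra h
  have h13 : (σ ^ k) ^ 13 = 1 := by rw [← pow_mul, mul_comm]; exact hσ
  exact no_aut_order_13 hV A h01 hsymm hdiag hk hsrg (σ ^ k) h13 h (adj_pow_invariant A σ hA k)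

/-- **Prime-order spectrum (gen 30): `p ∈ {2, 3, 5, 7, 11, 37, 41, 83}`.** -/
theorem aut_prime_spectrum_g30 (hV : Fintype.card V = 333) (A : Matrix V V ℤ)
    (h01 : ∀ x y, A x y = 0 ∨ A x y = 1) (hsymm : ∀ x y, A y x = A x y) (hdiag : ∀ x, A x x = 0)
    (hk : ∀ x, ∑ y, A x y = 166) (hsrg : ∀ x y, ∑ z, A x z * A z y = 83 * (1 + (if x = y then 1 else 0)) - A x y)
    {p : ℕ} (hp : p.Prime) (σ : Equiv.Perm V) (hσ : σ ^ p = 1) (hσ1 : σ ≠ 1)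
    (hA : ∀ x y, A (σ x) (σ y) = A x y) :
    p = 2 ∨ p = 3 ∨ p = 5 ∨ p = 7 ∨ p = 11 ∨ p = 37 ∨ p = 41 ∨ p = 83 := by
  have h := aut_prime_spectrum_fs hV A h01 hsymm hdiag hk hsrg hp σ hσ hσ1 hA
  have h13 : p ≠ 13 := by
    rintro rfl; exact no_aut_order_13 hV A h01 hsymm hdiag hk hsrg σ hσ hσ1 hA
  omega

/-- **Fixed-point windows of the surviving odd primes (gen 30):** `3: f ≡ 3 (6), 9 ≤ f ≤ 81` · `5: f ≡ 3 (10),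
13 ≤ f ≤ 53` · `7: f ∈ {25, 39}` · `11: f = 25` · `p ∉ {13, 17, 23}` · `37: f = 0` · `41: f = 5` · `83: f = 1`. -/
theorem aut_prime_windows_g30 (hV : Fintype.card V = 333) (A : Matrix V V ℤ)
    (h01 : ∀ x y, A x y = 0 ∨ A x y = 1) (hsymm : ∀ x y, A y x = A x y) (hdiag : ∀ x, A x x = 0)
    (hk : ∀ x, ∑ y, A x y = 166) (hsrg : ∀ x y, ∑ z, A x z * A z y = 83 * (1 + (if x = y then 1 else 0)) - A x y)
    {p : ℕ} (hp : p.Prime) (hp2 : p ≠ 2) (σ : Equiv.Perm V) (hσ : σ ^ p = 1) (hσ1 : σ ≠ 1)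
    (hA : ∀ x y, A (σ x) (σ y) = A x y) :
    let f := (univ.filter fun x => σ x = x).card
    (p = 3 → f % 6 = 3 ∧ 9 ≤ f ∧ f ≤ 81) ∧ (p = 5 → f % 10 = 3 ∧ 13 ≤ f ∧ f ≤ 53) ∧ (p = 7 → f = 25 ∨ f = 39) ∧
    (p = 11 → f = 25) ∧ (p ≠ 13) ∧ (p ≠ 17) ∧ (p ≠ 23) ∧ (p = 37 → f = 0) ∧ (p = 41 → f = 5) ∧ (p = 83 → f = 1) := by
  intro f
  obtain ⟨w3, w5, w7, w11, -, w17, w23, w37, w41, w83⟩ :=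
    aut_prime_windows_fs hV A h01 hsymm hdiag hk hsrg hp hp2 σ hσ hσ1 hA
  refine ⟨w3, w5, w7, w11, ?_, w17, w23, w37, w41, w83⟩
  rintro rfl; exact no_aut_order_13 hV A h01 hsymm hdiag hk hsrg σ hσ hσ1 hA

/-! ## Group level -/

/-- **Prime divisors of `|G|` (gen 30):** for any group `G` of automorphisms and prime `p ∣ |G|`,
`p ∈ {2, 3, 5, 7, 11, 37, 41, 83}`. -/
theorem autGroup_prime_dvd_card_g30 (hV : Fintype.card V = 333) (A : Matrix V V ℤ)
    (h01 : ∀ x y, A x y = 0 ∨ A x y = 1) (hsymm : ∀ x y, A y x = A x y) (hdiag : ∀ x, A x x = 0)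
    (hk : ∀ x, ∑ y, A x y = 166) (hsrg : ∀ x y, ∑ z, A x z * A z y = 83 * (1 + (if x = y then 1 else 0)) - A x y)
    (G : Subgroup (Equiv.Perm V)) (hG : ∀ g ∈ G, ∀ x y, A (g x) (g y) = A x y)
    {p : ℕ} (hp : p.Prime) (hdvd : p ∣ Nat.card G) :
    p = 2 ∨ p = 3 ∨ p = 5 ∨ p = 7 ∨ p = 11 ∨ p = 37 ∨ p = 41 ∨ p = 83 := by
  haveI := Fact.mk hp
  obtain ⟨g, hg⟩ := exists_prime_orderOf_dvd_card' p hdvd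
  have hg' : orderOf (g : Equiv.Perm V) = p := by rw [Subgroup.orderOf_coe, hg]
  have hgp : (g : Equiv.Perm V) ^ p = 1 := by rw [← hg']; exact pow_orderOf_eq_one _
  have hg1 : (g : Equiv.Perm V) ≠ 1 := by
    intro h
    rw [h, orderOf_one] at hg'
    exact hp.one_lt.ne hg'
  exact aut_prime_spectrum_g30 hV A h01 hsymm hdiag hk hsrg hp (g : Equiv.Perm V) hgp hg1 (hG g g.2)

/-- **`11² ∤ |G|`** (Burnside count in a subgroup of order `121`: not cyclic by `no_aut_order_121`, so `120` elements
of order `11` with `25` fixed points each (`aut_order11_fixed`); `333 + 120·25 = 3333` is not a multiple of `121`). -/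
theorem autGroup_card_not_dvd_11_sq (hV : Fintype.card V = 333) (A : Matrix V V ℤ)
    (h01 : ∀ x y, A x y = 0 ∨ A x y = 1) (hsymm : ∀ x y, A y x = A x y) (hdiag : ∀ x, A x x = 0)
    (hk : ∀ x, ∑ y, A x y = 166) (hsrg : ∀ x y, ∑ z, A x z * A z y = 83 * (1 + (if x = y then 1 else 0)) - A x y)
    (G : Subgroup (Equiv.Perm V)) (hG : ∀ g ∈ G, ∀ x y, A (g x) (g y) = A x y) :
    ¬ 11 ^ 2 ∣ Nat.card G := by
  classical
  intro hdvd
  haveI : Fact (Nat.Prime 11) := ⟨by norm_num⟩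
  obtain ⟨K, hK⟩ := Sylow.exists_subgroup_card_pow_prime 11 hdvd
  haveI : Fintype K := Fintype.ofFinite K
  have hKc : Fintype.card K = 121 := by rw [← Nat.card_eq_fintype_card, hK]; norm_num
  have hsmul : ∀ (k : K) (y : V), k • y = ((k : G) : Equiv.Perm V) y := fun _ _ => rfl
  -- every non-identity element of K has 11th power 1 and fixes 25 points
  have hfix : ∀ k : K, k ≠ 1 → Fintype.card (fixedBy V k) = 25 := by
    intro k hk1
    set kperm : Equiv.Perm V := ((k : G) : Equiv.Perm V) with hkperm_def
    have hkA : ∀ a b, A (kperm a) (kperm b) = A a b := hG kperm (k : G).2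
    have hord : orderOf kperm ∣ 11 ^ 2 := by
      rw [hkperm_def, Subgroup.orderOf_coe, Subgroup.orderOf_coe, ← hK]
      exact orderOf_dvd_natCard k
    have h121 : kperm ^ 121 = 1 := by
      have := orderOf_dvd_iff_pow_eq_one.mp hord
      simpa using this
    have hne : kperm ≠ 1 := by
      intro e
      apply hk1
      have : ((k : G) : Equiv.Perm V) = ((1 : K) : G) := by rw [← hkperm_def, e]; rfl
      exact Subtype.ext (Subtype.ext this)
    have h11 : kperm ^ 11 = 1 := by
      by_contra h11
      exact no_aut_order_121 hV A h01 hsymm hdiag hk hsrg kperm h121 h11 hkA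
    have hw := aut_order11_fixed hV A h01 hsymm hdiag hk hsrg kperm h11 hne hkA
    rw [← hw, ← Set.toFinset_card]
    congr 1
    ext y
    rw [Set.mem_toFinset, Finset.mem_filter, MulAction.mem_fixedBy, hsmul]
    simp [hkperm_def]
  -- Burnside
  have hB := MulAction.sum_card_fixedBy_eq_card_orbits_mul_card_group K V
  rw [hKc] at hB
  have hsplit : ∑ g : K, Fintype.card (fixedBy V g) = 333 + 120 * 25 := by
    rw [← Finset.sum_erase_add _ _ (Finset.mem_univ (1 : K))]
    have h1 : Fintype.card (fixedBy V (1 : K)) = 333 := by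
      rw [← hV, ← Set.toFinset_card]
      have : (fixedBy V (1 : K)).toFinset = univ := by
        ext y; simp [MulAction.fixedBy_one_eq_univ]
      rw [this, Finset.card_univ]
    rw [h1, Finset.sum_congr rfl fun g hg => hfix g (Finset.ne_of_mem_erase hg), Finset.sum_const,
      Finset.card_erase_of_mem (Finset.mem_univ _), Finset.card_univ, hKc, smul_eq_mul]
  rw [hsplit] at hB
  omega

/-- **Shape of `|Aut|` (gen 30).**  For every group `G` of automorphisms of an `srg(333,166,82,83)` and every prime
`p ∣ |G|`: `p ∈ {2,3,5,7,11,37,41,83}`, and `p² ∤ |G|` when `p ∈ {11, 37, 41, 83}` — i.e. `|G|` divides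
`2^a · 3^b · 5^c · 7^d · 11 · 37 · 41 · 83` for some exponents (gen 29: `… 11^e · 13 · 23 · 37 · 41 · 83`). -/
theorem autGroup_order_shape_g30 (hV : Fintype.card V = 333) (A : Matrix V V ℤ)
    (h01 : ∀ x y, A x y = 0 ∨ A x y = 1) (hsymm : ∀ x y, A y x = A x y) (hdiag : ∀ x, A x x = 0)
    (hk : ∀ x, ∑ y, A x y = 166) (hsrg : ∀ x y, ∑ z, A x z * A z y = 83 * (1 + (if x = y then 1 else 0)) - A x y)
    (G : Subgroup (Equiv.Perm V)) (hG : ∀ g ∈ G, ∀ x y, A (g x) (g y) = A x y) {p : ℕ} (hp : p.Prime)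
    (hdvd : p ∣ Nat.card G) :
    (p = 2 ∨ p = 3 ∨ p = 5 ∨ p = 7 ∨ p = 11 ∨ p = 37 ∨ p = 41 ∨ p = 83) ∧
      ((p = 11 ∨ p = 37 ∨ p = 41 ∨ p = 83) → ¬ p ^ 2 ∣ Nat.card G) := by
  refine ⟨autGroup_prime_dvd_card_g30 hV A h01 hsymm hdiag hk hsrg G hG hp hdvd, fun h4 => ?_⟩
  obtain ⟨-, h37, h41, h83⟩ := autGroup_card_not_dvd_23_37_41_83_sq hV A h01 hsymm hdiag hk hsrg G hG
  rcases h4 with rfl | rfl | rfl | rfl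
  · exact autGroup_card_not_dvd_11_sq hV A h01 hsymm hdiag hk hsrg G hG
  · exact h37
  · exact h41
  · exact h83

/-- **`13 ∤ |G|` and `23 ∤ |G|`** for every group `G` of automorphisms. -/
theorem autGroup_card_not_dvd_13_23 (hV : Fintype.card V = 333) (A : Matrix V V ℤ)
    (h01 : ∀ x y, A x y = 0 ∨ A x y = 1) (hsymm : ∀ x y, A y x = A x y) (hdiag : ∀ x, A x x = 0)
    (hk : ∀ x, ∑ y, A x y = 166) (hsrg : ∀ x y, ∑ z, A x z * A z y = 83 * (1 + (if x = y then 1 else 0)) - A x y)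
    (G : Subgroup (Equiv.Perm V)) (hG : ∀ g ∈ G, ∀ x y, A (g x) (g y) = A x y) :
    ¬ 13 ∣ Nat.card G ∧ ¬ 23 ∣ Nat.card G := by
  constructor
  · intro h
    have := autGroup_prime_dvd_card_g30 hV A h01 hsymm hdiag hk hsrg G hG (by norm_num) h
    omega
  · intro h
    have := autGroup_prime_dvd_card_g30 hV A h01 hsymm hdiag hk hsrg G hG (by norm_num) h
    omega

end order13

end Summit.Ventures.DiscreteObjects.Hadamard
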